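import Literature.RepresentationTheory.IsotypicFixedRank
import Literature.NumberTheory.Automorphic.FlathBaseVector
import HarnessLib

/-!
# The local types of an admissible representation of a restricted product are spherical at almost every place

Topic `NumberTheory/Automorphic` (restricted products; companion of ★ `FlathBaseVector`, ★ `RestrictedProductBoxes` and of the isotypic
calculus ★ `RepresentationTheory/IsotypicEvaluation`, ★ `RepresentationTheory/IsotypicFixedRank`).  THEOREMS ONLY — no definition, no
instance, no named-fact hypothesis.

Setting: `Γ = Πʳ_i [G i, K i]` a restricted product of groups with respect to subgroups `K i ≤ G i`, `π : Γ → GL(W)` a representation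
over a field `k`, `ι_i = mulSingleHom K i : G i →* Γ` the coordinate embeddings, and for every `i` an IRREDUCIBLE representation `τ_i` of
`G i` such that `π ∘ ι_i` is `τ_i`-ISOTYPIC (`isotypicComponent k[G i] (π ∘ ι_i) τ_i = ⊤`: «`τ_i` is the local type of `π` at `i`»; for
an irreducible smooth `π` of a restricted product of locally profinite groups such `τ_i` exist at every place, ★
`F0P2cStubCLLocalTypeExists` / Flath 1979 Thm. 2).
* §1 `step` — ONE PLACE: for `Y ≤ W` stable under a set `A ∋ ι_i(G i)` containing the box `∏ L` (`L i = K i`) with `Y ∩ W^{∏ L} ≠ 0`: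
  `τ_i^{K_i} ≠ 0` and `dim (Y ∩ W^{∏ L}) = dim τ_i^{K_i} · dim (Y' ∩ W^{∏ L[i ↦ 1]})` for some `Y' ≤ Y` stable under `{c ∈ A | c_i = 1}`
  (★ `IsotypicFixedRank.finrank_fixed_eq_mul_finrank_range_inf` on the restricted representation `Y`, with the box `∏ L[i ↦ 1]` as the
  commuting operators; `Y' = {f t₀ | f ∈ Hom_{G_i}(τ_i, Y)}`).
* §2 `prod_finrank_le` — FINITELY MANY PLACES, by induction: `∏_{i ∈ s} dim τ_i^{K_i} ≤ dim (Y ∩ W^{∏ L})` and each factor is `≥ 1`.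
* §3 `exists_injective_intertwiningMap`, **`isAdmissible_localType`** (the local types of an ADMISSIBLE `π` — `K i` compact open — are
  admissible: `τ_i ↪ W^{∏ L[i ↦ 1]}`, whose `L'`-fixed vectors are `W^{∏ L[i ↦ L']}`, finite-dimensional), `localType_exists_eq_smul`
  (hence scalar commutant over an algebraically closed field, ★ `Representation.IsAdmissible.exists_eq_smul_id`).
* §4 **`isSpherical_localType_cofinite`** — THE DIMENSION COUNT: `π` admissible on `W ≠ 0`, `k` algebraically closed ⇒
  `dim τ_i^{K_i} = 1` (`Representation.IsSpherical`) for all but finitely many `i`: a non-zero vector is fixed by a compact open box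
  `U = ∏ L_i` (★ `exists_boxSubgroup_le_of_mem_nhds`), `d = dim W^U < ∞`, and `d` places with `dim τ_i^{K_i} ≥ 2` inside `{L_i = K_i}`
  would force `2^d ≤ d` (`isSpherical_localType_cofinite_of_scalar` is the same with the scalar commutant as a hypothesis, any field).
This is Flath's «almost every local component of an admissible irreducible representation of `G(𝔸)` is unramified (class one)», proved
by the dimension count `dim (⊗ V_v)^{∏ K_v} = ∏ dim V_v^{K_v}` read WITHOUT a tensor-product structure on `π` (only isotypy at each
place is used), so that it serves the uniqueness half of Flath's theorem (cell hodgecm-mathlib, floor 0, (C)-line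
`F0_P2CohFinComponentIsThetaC`, stub CF «Flath rigidity», road file (4); the `U(J)(𝔸_{F,f})` transport is
`Automorphic/UnitaryGroupLocalTypeSpherical`).

## References
* D. Flath, *Decomposition of representations into tensor products*, in: Automorphic Forms, Representations and `L`-functions, PSPM 33.1
  (1979), 179–183: §2 Example 2 (`(⊗' V_v)^{∏ K_v} = ⊗ V_v^{K_v}`), Theorem 2, Theorem 3.
* D. Bump, *Automorphic Forms and Representations*, CUP (1997): §3.4, Prop. 3.4.1–3.4.2 (isotypic calculus, PDF p. 302) and Prop. 4.2.4
  (Schur's lemma for admissible representations).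
-/

set_option autoImplicit false

noncomputable section

open scoped RestrictedProduct MonoidAlgebra
open Filter Module

namespace Literature.NumberTheory.Automorphic

namespace LocalTypeSpherical

universe u v w w' uk

variable {ι : Type u} [DecidableEq ι] {G : ι → Type v} [∀ i, Group (G i)]
  {K : ∀ i, Subgroup (G i)} {k : Type uk} [Field k] {W : Type w} [AddCommGroup W] [Module k W]
  (π : Representation k (Πʳ i, [G i, K i]) W)
  {T : ι → Type w'} [∀ i, AddCommGroup (T i)] [∀ i, Module k (T i)]
  (τ : ∀ i, Representation k (G i) (T i))

/-! ## §1 One place: the fixed vectors of `Y` under a box split as `τ_i^{K_i} ⊗ (…)` -/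

/-- The restriction of `π ∘ ι_i` to a `ι_i(G i)`-stable `k`-submodule `Y` (Mathlib `Subrepresentation.toRepresentation`), unfolded.
[cite: FlathCorvallis1979, §2 Example 2] -/
theorem subrep_coe_apply (i : ι) {Y : Submodule k W} (hY : ∀ g : G i, ∀ y ∈ Y, π (mulSingleHom K i g) y ∈ Y) (g : G i) (y : Y) :
    (((⟨Y, fun g _ hv => hY g _ hv⟩ : Subrepresentation (π.comp (mulSingleHom K i))).toRepresentation g y : Y) : W) =
      π (mulSingleHom K i g) y := rfl

/-- **The one-place step of the count.**  Let `Y ≤ W` be stable under a set `A` of group elements containing `ι_i(G i)` and the box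
`∏ L` (`L i = K i`), let `π ∘ ι_i` be `τ_i`-isotypic with `τ_i` irreducible of scalar commutant, and suppose `Y ∩ W^{∏ L} ≠ 0`.  Then
`τ_i^{K_i} ≠ 0` and there is `Y' ≤ Y`, stable under `{c ∈ A | c_i = 1}`, with
`dim (Y ∩ W^{∏ L}) = dim τ_i^{K_i} · dim (Y' ∩ W^{∏ L[i ↦ 1]})` (`Y' = {f t₀}` for the evaluation of `Hom_{G_i}(τ_i, Y)` at a non-zero
`t₀ ∈ τ_i^{K_i}`; ★ `IsotypicFixedRank`). [cite: FlathCorvallis1979, §2 Example 2] [cite: Bump1997, Prop. 3.4.2] -/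
theorem step (i : ι) [(τ i).IsIrreducible] (hτ : ∀ φ : (τ i).IntertwiningMap (τ i), ∃ c : k, ∀ x, φ x = c • x)
    (hiso : isotypicComponent k[G i] (Representation.asModule (π.comp (mulSingleHom K i))) (τ i).asModule = ⊤)
    (L : ∀ i, Subgroup (G i)) (hLi : L i = K i) (A : Set (Πʳ i, [G i, K i])) (Y : Submodule k W)
    (hAY : ∀ c ∈ A, ∀ y ∈ Y, π c y ∈ Y) (hAi : ∀ g : G i, mulSingleHom K i g ∈ A)
    (hAbox : ∀ c ∈ boxSubgroup (K := K) L, c ∈ A)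
    (h1 : 1 ≤ finrank k ↥(Y ⊓ π.fixedPoints (boxSubgroup L))) :
    1 ≤ finrank k ((τ i).fixedPoints (K i)) ∧
    ∃ Y' : Submodule k W, Y' ≤ Y ∧ (∀ c ∈ A, c i = 1 → ∀ y ∈ Y', π c y ∈ Y') ∧
      finrank k ↥(Y ⊓ π.fixedPoints (boxSubgroup L)) =
        finrank k ((τ i).fixedPoints (K i)) * finrank k ↥(Y' ⊓ π.fixedPoints (boxSubgroup (Function.update L i ⊥))) := by
  classical
  -- the restricted representation on `Y`
  have hY : ∀ g : G i, ∀ y ∈ Y, π (mulSingleHom K i g) y ∈ Y := fun g y hy => hAY _ (hAi g) y hy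
  set πY : Representation k (G i) Y :=
    ((⟨Y, fun g _ hv => hY g _ hv⟩ : Subrepresentation (π.comp (mulSingleHom K i))).toRepresentation) with hπY
  have hπY_apply : ∀ (g : G i) (y : Y), ((πY g y : Y) : W) = π (mulSingleHom K i g) y := fun g y => rfl
  have hisoY : isotypicComponent k[G i] πY.asModule (τ i).asModule = ⊤ :=
    Literature.RepresentationTheory.isotypicComponent_subrep_eq_top (τ i) (π.comp (mulSingleHom K i)) hiso hY
  -- the commuting operators: the box with trivial `i`-th side, restricted to `Y`
  set B' : Subgroup (Πʳ i, [G i, K i]) := boxSubgroup (K := K) (Function.update L i ⊥) with hB'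
  have hB'A : ∀ c ∈ B', c ∈ A := fun c hc => hAbox c (boxSubgroup_mono (fun j => by
    by_cases hj : j = i
    · subst hj; simp
    · simp [Function.update_of_ne hj]) hc)
  have hB'Y : ∀ c ∈ B', ∀ y ∈ Y, π c y ∈ Y := fun c hc => hAY c (hB'A c hc)
  let res : ∀ c ∈ B', Y →ₗ[k] Y := fun c hc => (π c).restrict (hB'Y c hc)
  have hres : ∀ c (hc : c ∈ B') (y : Y), ((res c hc y : Y) : W) = π c y := fun c hc y => rfl
  set 𝒪 : Set (Y →ₗ[k] Y) := {u | ∃ c, ∃ hc : c ∈ B', u = res c hc} with h𝒪def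
  have h𝒪 : ∀ u ∈ 𝒪, ∀ g : G i, u ∘ₗ πY g = πY g ∘ₗ u := by
    rintro u ⟨c, hc, rfl⟩ g
    ext y
    show π c (π (mulSingleHom K i g) y) = π (mulSingleHom K i g) (π c y)
    rw [← Module.End.mul_apply, ← map_mul, mul_mulSingleHom_comm_of_mem_boxSubgroup_update_bot hc, map_mul, Module.End.mul_apply]
  -- the joint fixed spaces inside `Y`
  set P : Submodule k Y := (π.fixedPoints (boxSubgroup L)).comap Y.subtype with hPdef
  set R : Submodule k Y := (π.fixedPoints B').comap Y.subtype with hRdef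
  have hRmem : ∀ v : Y, v ∈ R ↔ ∀ u ∈ 𝒪, u v = v := by
    intro v
    rw [hRdef, Submodule.mem_comap, Submodule.subtype_apply, Representation.mem_fixedPoints]
    constructor
    · rintro h u ⟨c, hc, rfl⟩
      exact Subtype.ext (h c hc)
    · intro h c hc
      exact congrArg Subtype.val (h (res c hc) ⟨c, hc, rfl⟩)
  have hPmem : ∀ v : Y, v ∈ P ↔ (∀ g ∈ K i, πY g v = v) ∧ ∀ u ∈ 𝒪, u v = v := by
    intro v
    rw [← hRmem, hPdef, hRdef, Submodule.mem_comap, Submodule.mem_comap, Submodule.subtype_apply,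
      ← boxSubgroup_update_self L i, mem_fixedPoints_boxSubgroup_update_iff, hLi, and_comm, hB']
    refine and_congr ?_ Iff.rfl
    rw [Representation.mem_fixedPoints]
    exact ⟨fun h g hg => Subtype.ext (h g hg), fun h g hg => congrArg Subtype.val (h g hg)⟩
  -- `P` read in `W` is `Y ∩ W^{∏ L}`
  have hPmap : P.map Y.subtype = Y ⊓ π.fixedPoints (boxSubgroup L) := by rw [hPdef, Submodule.map_comap_subtype]
  have hfinP : finrank k P = finrank k ↥(Y ⊓ π.fixedPoints (boxSubgroup L)) := by
    rw [← hPmap]; exact LinearEquiv.finrank_eq (Submodule.equivMapOfInjective _ Y.injective_subtype P)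
  have h1P : 1 ≤ finrank k P := hfinP ▸ h1
  -- a non-zero `K i`-fixed vector of `τ i`
  obtain ⟨t₀, ht₀K, ht₀⟩ := Literature.RepresentationTheory.exists_fixedPoints_ne_zero (τ i) πY hτ hisoY (K i) 𝒪 h𝒪 P hPmem h1P
  obtain ⟨ev, hev⟩ := Literature.RepresentationTheory.exists_eval (τ i) πY t₀
  have hmain := Literature.RepresentationTheory.finrank_fixed_eq_mul_finrank_range_inf (τ i) πY hτ hisoY (K i) 𝒪 h𝒪 P hPmem R hRmem
    ht₀K ht₀ ev hev
  have hpos : 1 ≤ finrank k ((τ i).fixedPoints (K i)) := by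
    rcases Nat.eq_zero_or_pos (finrank k ((τ i).fixedPoints (K i))) with h0 | h0
    · rw [h0, zero_mul] at hmain; omega
    · exact h0
  refine ⟨hpos, (LinearMap.range ev).map Y.subtype, Submodule.map_subtype_le _ _, ?_, ?_⟩
  · -- stability of `Y' = {f t₀}` under `{c ∈ A | c i = 1}`
    rintro c hcA hci _ ⟨v, hv, rfl⟩
    have hcY : ∀ y ∈ Y, π c y ∈ Y := hAY c hcA
    have hcomm : ∀ g : G i, (π c).restrict hcY ∘ₗ πY g = πY g ∘ₗ (π c).restrict hcY := fun g => by
      ext y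
      show π c (π (mulSingleHom K i g) y) = π (mulSingleHom K i g) (π c y)
      rw [← Module.End.mul_apply, ← map_mul, mulSingleHom_apply, mul_mulSingle_comm_of_apply_eq_one hci, map_mul,
        Module.End.mul_apply]
    have := Literature.RepresentationTheory.map_range_eval_le (τ i) πY t₀ ev hev ((π c).restrict hcY) hcomm v hv
    exact ⟨(π c).restrict hcY v, this, rfl⟩
  · -- the rank identity, read in `W`
    rw [← hfinP, hmain]
    congr 1
    have hmap : (LinearMap.range ev ⊓ R).map Y.subtype =
        (LinearMap.range ev).map Y.subtype ⊓ π.fixedPoints B' := by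
      rw [Submodule.map_inf _ Y.injective_subtype, hRdef, Submodule.map_comap_subtype, ← inf_assoc,
        inf_eq_left.2 (Submodule.map_subtype_le Y _)]
    rw [hB'] at hmap
    rw [← hmap]
    exact LinearEquiv.finrank_eq (Submodule.equivMapOfInjective _ Y.injective_subtype _)

/-! ## §2 Finitely many places: `∏_{i ∈ s} dim τ_i^{K_i} ≤ dim (Y ∩ W^{∏ L})` -/

/-- **The count over a finite set of places.**  For a finite set `s` of indices with `L i = K i` on `s`, a submodule `Y` stable under a
set `A ∋ ι_i(G i) (i ∈ s)` containing the box `∏ L`, and `Y ∩ W^{∏ L} ≠ 0`: every `τ_i^{K_i}` (`i ∈ s`) is non-zero and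
`∏_{i ∈ s} dim τ_i^{K_i} ≤ dim (Y ∩ W^{∏ L})` — induction on `s`, peeling one place at a time with `step` (the next step runs inside
`Y' = {f t₀}` with the box `∏ L[i ↦ 1]` and the operators `{c ∈ A | c_i = 1}`).  (Flath 1979, §2 Example 2:
`dim (⊗ V_v)^{∏ K_v} = ∏ dim V_v^{K_v}`, here as an inequality needing no tensor-product structure.)
[cite: FlathCorvallis1979, §2 Example 2] [cite: Bump1997, Prop. 3.4.2] -/
theorem prod_finrank_le (hirr : ∀ i, (τ i).IsIrreducible)
    (hτ : ∀ i, ∀ φ : (τ i).IntertwiningMap (τ i), ∃ c : k, ∀ x, φ x = c • x)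
    (hiso : ∀ i, isotypicComponent k[G i] (Representation.asModule (π.comp (mulSingleHom K i))) (τ i).asModule = ⊤)
    (s : Finset ι) :
    ∀ (L : ∀ i, Subgroup (G i)) (A : Set (Πʳ i, [G i, K i])) (Y : Submodule k W),
      (∀ i ∈ s, L i = K i) → (∀ c ∈ A, ∀ y ∈ Y, π c y ∈ Y) → (∀ i ∈ s, ∀ g : G i, mulSingleHom K i g ∈ A) →
      (∀ c ∈ boxSubgroup (K := K) L, c ∈ A) → 1 ≤ finrank k ↥(Y ⊓ π.fixedPoints (boxSubgroup L)) →
      (∀ i ∈ s, 1 ≤ finrank k ((τ i).fixedPoints (K i))) ∧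
        ∏ i ∈ s, finrank k ((τ i).fixedPoints (K i)) ≤ finrank k ↥(Y ⊓ π.fixedPoints (boxSubgroup L)) := by
  classical
  induction s using Finset.induction_on with
  | empty =>
    intro L A Y _ _ _ _ h1
    exact ⟨fun i hi => absurd hi (Finset.notMem_empty i), by simpa using h1⟩
  | insert i₀ s hi₀ ih =>
    intro L A Y hL hAY hAi hAbox h1
    haveI := hirr i₀
    obtain ⟨hpos, Y', hY'Y, hAY', hdim⟩ := step π τ i₀ (hτ i₀) (hiso i₀) L (hL i₀ (Finset.mem_insert_self _ _)) A Y hAY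
      (hAi i₀ (Finset.mem_insert_self _ _)) hAbox h1
    -- the data one place further: the box `∏ L[i₀ ↦ 1]`, the operators `{c ∈ A | c i₀ = 1}`, the space `Y'`
    have hL' : ∀ i ∈ s, Function.update L i₀ ⊥ i = K i := fun i hi => by
      rw [Function.update_of_ne (ne_of_mem_of_not_mem hi hi₀)]
      exact hL i (Finset.mem_insert_of_mem hi)
    have hAi' : ∀ i ∈ s, ∀ g : G i, mulSingleHom K i g ∈ {c ∈ A | c i₀ = 1} := fun i hi g =>
      ⟨hAi i (Finset.mem_insert_of_mem hi) g, by
        rw [mulSingleHom_apply_apply, Pi.mulSingle_eq_of_ne (ne_of_mem_of_not_mem hi hi₀).symm]⟩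
    have hAbox' : ∀ c ∈ boxSubgroup (K := K) (Function.update L i₀ ⊥), c ∈ {c ∈ A | c i₀ = 1} := fun c hc =>
      ⟨hAbox c (boxSubgroup_mono (fun j => by
          by_cases hj : j = i₀
          · subst hj; simp
          · simp [Function.update_of_ne hj]) hc),
        apply_eq_one_of_mem_boxSubgroup_update_bot hc⟩
    have h1' : 1 ≤ finrank k ↥(Y' ⊓ π.fixedPoints (boxSubgroup (Function.update L i₀ ⊥))) := by
      rcases Nat.eq_zero_or_pos (finrank k ↥(Y' ⊓ π.fixedPoints (boxSubgroup (Function.update L i₀ ⊥)))) with h0 | h0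
      · rw [h0, mul_zero] at hdim; omega
      · exact h0
    obtain ⟨hpos', hprod⟩ := ih (Function.update L i₀ ⊥) {c ∈ A | c i₀ = 1} Y' hL'
      (fun c hc y hy => hAY' c hc.1 hc.2 y (by exact hy)) hAi' hAbox' h1'
    refine ⟨fun i hi => ?_, ?_⟩
    · rcases Finset.mem_insert.1 hi with rfl | hi
      · exact hpos
      · exact hpos' i hi
    · rw [Finset.prod_insert hi₀, hdim]
      exact Nat.mul_le_mul_left _ hprod

/-! ## §3 The local types of an admissible representation are admissible, hence have scalar commutant -/

section Admissible

omit [DecidableEq ι] in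
/-- A `τ`-isotypic representation on a non-zero space receives an INJECTIVE intertwiner from `τ` (a simple submodule of the semisimple
module `W` is isomorphic to `τ`). [cite: Bump1997, Prop. 3.4.1] -/
theorem exists_injective_intertwiningMap {H : Type*} [Group H] {V X : Type*} [AddCommGroup V] [Module k V] [AddCommGroup X]
    [Module k X] (σ : Representation k H V) (ρ : Representation k H X) [σ.IsIrreducible] [Nontrivial X]
    (hiso : isotypicComponent k[H] ρ.asModule σ.asModule = ⊤) :
    ∃ f : σ.IntertwiningMap ρ, Function.Injective f := by
  haveI := Literature.RepresentationTheory.isSemisimpleModule_of_isotypicComponent_eq_top σ ρ hiso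
  haveI : Nontrivial ρ.asModule := (inferInstance : Nontrivial X)
  obtain ⟨m, hm⟩ := IsAtomic.exists_atom (Submodule k[H] ρ.asModule)
  rw [← isSimpleModule_iff_isAtom] at hm
  obtain ⟨e⟩ := IsIsotypicOfType.of_isotypicComponent_eq_top hiso m
  refine ⟨(Representation.IntertwiningMap.equivLinearMapAsModule σ ρ).symm (m.subtype ∘ₗ e.symm.toLinearMap), ?_⟩
  intro a b h
  exact e.symm.injective (Subtype.ext h)

variable [∀ i, TopologicalSpace (G i)] [∀ i, IsTopologicalGroup (G i)]

/-- **The local types of an admissible representation are admissible.**  Let the `K i` be compact open, `π` admissible on `W ≠ 0`, and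
`π ∘ ι_i` `τ_i`-isotypic with `τ_i` irreducible.  Then `τ_i` is admissible: it embeds `G_i`-equivariantly into `W` (so it is smooth), and
for `t₀ ≠ 0` and a compact open box `∏ L` fixing the image of `t₀`, the image of `τ_i` lies in `W' = W^{∏ L[i ↦ 1]}` (a `ι_i(G_i)`-stable
subspace containing it, by irreducibility), whose `L'`-fixed vectors `W^{∏ L[i ↦ L']}` are finite-dimensional for every compact open
`L' ≤ K_i`. (Flath 1979, §2; Bump 1997, Prop. 3.4.2 and §4.2.) [cite: FlathCorvallis1979, §2 Example 2] [cite: Bump1997, Prop. 3.4.2] -/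
theorem isAdmissible_localType (hK : ∀ i, IsOpen (K i : Set (G i))) (hKc : ∀ i, IsCompact (K i : Set (G i)))
    (hadm : π.IsAdmissible) [Nontrivial W] (i : ι) [(τ i).IsIrreducible]
    (hiso : isotypicComponent k[G i] (Representation.asModule (π.comp (mulSingleHom K i))) (τ i).asModule = ⊤) :
    (τ i).IsAdmissible := by
  classical
  obtain ⟨f, hf⟩ := exists_injective_intertwiningMap (τ i) (π.comp (mulSingleHom K i)) hiso
  have hfg : ∀ (g : G i) (t : T i), f (τ i g t) = π (mulSingleHom K i g) (f t) := fun g t => by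
    rw [f.isIntertwining]; rfl
  -- smoothness: stabilisers agree along the injective intertwiner `f`
  have hsm : (τ i).IsSmooth := by
    intro t
    have hst : (τ i).stabilizerSubgroup t = (π.stabilizerSubgroup (f t)).comap (mulSingleHom K i) := by
      ext g
      simp only [Representation.mem_stabilizerSubgroup, Subgroup.mem_comap]
      rw [← hfg]
      exact ⟨fun h => by rw [h], fun h => hf h⟩
    change IsOpen (((τ i).stabilizerSubgroup t : Set (G i)))
    rw [hst]
    exact (hadm.1 (f t)).preimage (continuous_mulSingleHom i)
  refine ⟨hsm, fun U hU => ?_⟩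
  -- a compact open box fixing `f t₀`
  haveI : Nontrivial (T i) := Representation.IsIrreducible.nontrivial (τ i)
  obtain ⟨t₀, ht₀⟩ := exists_ne (0 : T i)
  obtain ⟨L, hLo, hLc, hLK, hLK', hsub⟩ := exists_boxSubgroup_le_of_mem_nhds hK hKc (π.stabilizerSubgroup (f t₀))
    ((hadm.1 (f t₀)).mem_nhds (π.stabilizerSubgroup (f t₀)).one_mem)
  -- the image of `τ i` lies in `W' = W^{∏ L[i ↦ 1]}`
  have hW' : ∀ t, f t ∈ π.fixedPoints (boxSubgroup (Function.update L i ⊥)) := by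
    let N : Subrepresentation (τ i) :=
      ⟨(π.fixedPoints (boxSubgroup (Function.update L i ⊥))).comap f.toLinearMap, fun g t ht => by
        simp only [Submodule.mem_comap, Representation.IntertwiningMap.toLinearMap_apply] at ht ⊢
        rw [hfg]
        exact span_range_mulSingleHom_le_fixedPoints_update_bot π L i ht
          (Submodule.subset_span ⟨g, rfl⟩)⟩
    have hNtop : N = ⊤ := by
      rcases IsSimpleOrder.eq_bot_or_eq_top N with h | h
      · exfalso
        have ht₀N : t₀ ∈ N.toSubmodule := by
          change f t₀ ∈ π.fixedPoints (boxSubgroup (Function.update L i ⊥))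
          refine mem_fixedPoints_boxSubgroup_update_bot π L i ?_
          rw [Representation.mem_fixedPoints]
          intro c hc
          exact hsub hc
        rw [h] at ht₀N
        exact ht₀ ((Submodule.mem_bot k).1 ht₀N)
      · exact h
    intro t
    have ht : t ∈ N.toSubmodule := by rw [hNtop]; trivial
    exact ht
  -- finiteness of `τ_i^{U}`: through `U ∩ K_i` and the finite-dimensional `W^{∏ L[i ↦ U ∩ K_i]}`
  set L' : Subgroup (G i) := (U : Subgroup (G i)) ⊓ K i with hL'
  have hL'o : IsOpen (L' : Set (G i)) := U.isOpen.inter (hK i)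
  have hL'c : IsCompact (L' : Set (G i)) :=
    (hKc i).of_isClosed_subset (L'.isClosed_of_isOpen hL'o) fun g hg => hg.2
  haveI := finite_fixedPoints_boxSubgroup_update π hadm hLo hLc hLK hLK' i hL'o hL'c (inf_le_right : L' ≤ K i)
  have hmap : ∀ t ∈ (τ i).fixedPoints (U : Subgroup (G i)),
      f.toLinearMap t ∈ π.fixedPoints (boxSubgroup (Function.update L i L')) := by
    intro t ht
    rw [mem_fixedPoints_boxSubgroup_update_iff]
    refine ⟨hW' t, ?_⟩
    rw [Representation.mem_fixedPoints] at ht ⊢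
    intro g hg
    change π (mulSingleHom K i g) (f t) = f t
    rw [← hfg, ht g hg.1]
  exact Module.Finite.of_injective (f.toLinearMap.restrict hmap) fun x y hxy =>
    Subtype.ext (hf (congrArg Subtype.val hxy :))

/-- **Schur for the local types of an admissible representation** (`k` algebraically closed): every self-intertwiner of `τ_i` is a
scalar (★ `Representation.IsAdmissible.exists_eq_smul_id` on the admissible irreducible `τ_i`, `isAdmissible_localType`).
[cite: Bump1997, Proposition 4.2.4] -/
theorem localType_exists_eq_smul [IsAlgClosed k] (hK : ∀ i, IsOpen (K i : Set (G i)))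
    (hKc : ∀ i, IsCompact (K i : Set (G i))) (hadm : π.IsAdmissible) [Nontrivial W] (i : ι) [(τ i).IsIrreducible]
    (hiso : isotypicComponent k[G i] (Representation.asModule (π.comp (mulSingleHom K i))) (τ i).asModule = ⊤)
    (φ : (τ i).IntertwiningMap (τ i)) : ∃ c : k, ∀ x, φ x = c • x := by
  obtain ⟨c, hc⟩ := Representation.IsAdmissible.exists_eq_smul_id (isAdmissible_localType π τ hK hKc hadm i hiso) (hK i)
    (hKc i) φ.toLinearMap φ.isIntertwining'
  exact ⟨c, fun x => by simpa using LinearMap.congr_fun hc x⟩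

end Admissible

/-! ## §4 The dimension count: almost every local type is spherical -/

section Main

variable [∀ i, TopologicalSpace (G i)] [∀ i, IsTopologicalGroup (G i)]

/-- **The local types of an admissible representation of a restricted product are spherical at almost every place** (with the scalar
commutant of the `τ_i` as a hypothesis; see `isSpherical_localType_cofinite` for `k` algebraically closed).  Let the `K i` be compact open,
`π` an admissible representation of `Πʳ_i [G i, K i]` on `W ≠ 0`, and `τ_i` irreducible representations of the `G i` such that `π ∘ ι_i`
is `τ_i`-isotypic for every `i`.  Then `dim τ_i^{K_i} = 1` for all but finitely many `i`.  PROOF (the dimension count): a non-zero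
vector is fixed by a compact open box `U = ∏ L_i` (`L_i = K_i` off a finite set), `d := dim W^U < ∞` by admissibility; for any finite
set `s` of places with `L_i = K_i`, `prod_finrank_le` gives `dim τ_i^{K_i} ≥ 1` on `s` and `∏_{i ∈ s} dim τ_i^{K_i} ≤ d`; if
infinitely many `i` had `dim τ_i^{K_i} ≠ 1`, `d` of them would give `2^d ≤ d`.  (Flath 1979, §2 Example 2 with Thm. 2: the local
components of an admissible irreducible `⊗' π_v` are unramified — `dim π_v^{K_v} = 1` — for almost all `v`; Bump 1997, §3.4.)
[cite: FlathCorvallis1979, §2 Example 2] [cite: Bump1997, Prop. 3.4.2] -/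
theorem isSpherical_localType_cofinite_of_scalar (hK : ∀ i, IsOpen (K i : Set (G i)))
    (hKc : ∀ i, IsCompact (K i : Set (G i))) (hadm : π.IsAdmissible) [Nontrivial W]
    (hirr : ∀ i, (τ i).IsIrreducible) (hτ : ∀ i, ∀ φ : (τ i).IntertwiningMap (τ i), ∃ c : k, ∀ x, φ x = c • x)
    (hiso : ∀ i, isotypicComponent k[G i] (Representation.asModule (π.comp (mulSingleHom K i))) (τ i).asModule = ⊤) :
    ∀ᶠ i in cofinite, (τ i).IsSpherical (K i) := by
  classical
  -- a compact open box fixing a non-zero vector; `d := dim W^U`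
  obtain ⟨w, hw⟩ := exists_ne (0 : W)
  obtain ⟨L, hLo, hLc, hLK, hLK', hsub⟩ := exists_boxSubgroup_le_of_mem_nhds hK hKc (π.stabilizerSubgroup w)
    ((hadm.1 w).mem_nhds (π.stabilizerSubgroup w).one_mem)
  haveI := finite_fixedPoints_boxSubgroup π hadm hLo hLc hLK hLK'
  set d := finrank k ↥(π.fixedPoints (boxSubgroup L)) with hd
  have hwU : w ∈ π.fixedPoints (boxSubgroup L) := by
    rw [Representation.mem_fixedPoints]
    intro g hg
    exact hsub hg
  have hd1 : 1 ≤ d :=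
    Module.finrank_pos_iff_exists_ne_zero.2 ⟨⟨w, hwU⟩, fun h => hw (congrArg Subtype.val h)⟩
  -- the count over any finite set of good places
  have hkey : ∀ s : Finset ι, (∀ i ∈ s, L i = K i) →
      (∀ i ∈ s, 1 ≤ finrank k ((τ i).fixedPoints (K i))) ∧ ∏ i ∈ s, finrank k ((τ i).fixedPoints (K i)) ≤ d := by
    intro s hs
    have h := prod_finrank_le π τ hirr hτ hiso s L Set.univ ⊤ hs (fun _ _ _ _ => trivial) (fun _ _ _ => trivial)
      (fun _ _ => trivial)
    rw [top_inf_eq] at h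
    exact h hd1
  -- the bad set among the good places is finite: `d` bad places would give `2 ^ d ≤ d`
  have hbad : {i | L i = K i ∧ ¬ (τ i).IsSpherical (K i)}.Finite := by
    by_contra hinf
    obtain ⟨s, hs, hcard⟩ := Set.Infinite.exists_subset_card_eq hinf d
    obtain ⟨hpos, hprod⟩ := hkey s fun i hi => (hs hi).1
    have h2 : ∀ i ∈ s, 2 ≤ finrank k ((τ i).fixedPoints (K i)) := fun i hi => by
      have h1 := hpos i hi
      have hne : finrank k ((τ i).fixedPoints (K i)) ≠ 1 := (hs hi).2
      omega
    have hpow : 2 ^ d ≤ d :=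
      calc 2 ^ d = ∏ _i ∈ s, 2 := by rw [Finset.prod_const, hcard]
        _ ≤ ∏ i ∈ s, finrank k ((τ i).fixedPoints (K i)) := Finset.prod_le_prod' h2
        _ ≤ d := hprod
    exact absurd hpow (not_le.2 (Nat.lt_two_pow_self (n := d)))
  refine (hLK'.and hbad.compl_mem_cofinite).mono fun i hi => ?_
  by_contra h
  exact hi.2 ⟨hi.1, h⟩

/-- **The local types of an admissible representation of a restricted product are spherical at almost every place.**  `k` algebraically
closed, `K i ≤ G i` compact open subgroups of topological groups, `π` an admissible representation of `Πʳ_i [G i, K i]` on `W ≠ 0`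
(e.g. `π` irreducible admissible), `τ_i` irreducible with `π ∘ ι_i` `τ_i`-isotypic for every `i` (the LOCAL TYPES of `π`): then
`τ_i` is `K_i`-spherical, `dim τ_i^{K_i} = 1`, for all but finitely many `i` (`isSpherical_localType_cofinite_of_scalar` with the scalar
commutant supplied by `localType_exists_eq_smul`).  (Flath 1979, Thm. 2 / §2 Example 2; Bump 1997, §3.4, Prop. 3.4.2 ff.)
[cite: FlathCorvallis1979, §2 Example 2] [cite: Bump1997, Prop. 3.4.2] -/
theorem isSpherical_localType_cofinite [IsAlgClosed k] (hK : ∀ i, IsOpen (K i : Set (G i)))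
    (hKc : ∀ i, IsCompact (K i : Set (G i))) (hadm : π.IsAdmissible) [Nontrivial W]
    (hirr : ∀ i, (τ i).IsIrreducible)
    (hiso : ∀ i, isotypicComponent k[G i] (Representation.asModule (π.comp (mulSingleHom K i))) (τ i).asModule = ⊤) :
    ∀ᶠ i in cofinite, (τ i).IsSpherical (K i) :=
  isSpherical_localType_cofinite_of_scalar π τ hK hKc hadm hirr
    (fun i φ => by haveI := hirr i; exact localType_exists_eq_smul π τ hK hKc hadm i (hiso i) φ) hiso

end Main

end LocalTypeSpherical

end Literature.NumberTheory.Automorphic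

end
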